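import Summits.HodgeConjecture.HodgeConjecture.Theorems.WeilTypeLadderBlochSeed
import HarnessLib

/-!
# Venture HSemireg (cell `pub-hsemireg`) — TRANSFER: «one computed semiregular representative (an integral
# Bloch-semiregular local complete intersection at one anchor) ⟹ a named case of the variational Hodge conjecture»

HONEST FRAMING. This is part of the Lean index of a COMPUTATION cell (the CYCLE door; companions: `Certificate.lean` —
the exact-certificate contract —, `SheafSeed.lean` — the vector-bundle door —, and the thin index `Statement.lean`), NOT a
claim about the Hodge conjecture. The cell
computes, exactly (rational / number-field linear algebra), Bloch's semiregularity map
`π : H¹(Z, 𝒩_{Z/X}) → H^{p+1}(X, Ω^{p-1}_X)` (Bloch 1972, §1) for EXPLICIT local complete intersections `Z` on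
CM abelian varieties `X` (`E^n`, `E` a CM elliptic curve; then abelian varieties of Weil type) and decides
its injectivity. This file says, in the tree's existing vocabulary and with every input named, WHAT such a
computation certifies and WHAT FOLLOWS from it by theorems already kernel-checked in the tree. Nothing is
asserted: every published theorem enters as a hypothesis BY NAME (a `def … : Prop` of `Literature/`), every
open input is a hypothesis, and the only new declarations are two existential predicates (the cell's
verdict shapes) and compositions of landed theorems. No number computed by the cell is used here.

## Vocabulary (all REAL definitions of the tree; nothing is re-declared)

* `IsBlochSemiregular i n p` (`Literature/…/BlochSemiregularityMapReal.lean`): `Z ↪ X` (`i` a closed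
  immersion, `X` of dimension `n`, `Z` a local complete intersection of codimension `p`, `m = n - p`) is
  semiregular in the sense of Bloch — rendered, exactly as Bloch §1 / Buchweitz–Flenner (8.1)(2) DEFINE `π`
  (by Serre duality), as SURJECTIVITY of the map `H^{m-1}(X, Ω^{m+1}_X) → H^{m-1}(Z, 𝒩^∨ ⊗ ω_Z)` that `π`
  transposes (`blochPairingMap i (p-1) (m+1) (m-1)`). THIS is the map the cell's engines compute; the
  companion file `Certificate.lean` turns an exact matrix of it plus a right inverse (resp. a left-kernel
  vector) into `IsBlochSemiregular` (resp. its negation), given the coordinates.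
* `IsRegularImmersionOfCodim i p` (`BlochSemiregularSpread.lean`): local complete intersection of
  codimension `p`. `classesSupportedOn X Z k`: classes in `Hᵏ(X(ℂ); ℂ)` supported on `Z`.
* `HasBlochSeedAt n P h w` (`WeilClassesBlochSeed.lean`) — THE OBJECT: on the abelian `2n`-fold `P`, an
  INTEGRAL closed lci `Z ↪ P` of codimension `n`, Bloch-semiregular (`IsBlochSemiregular i (2n) n`), and
  `q ∈ ℚ` with the class `q·hⁿ + w` supported on `Z` — Bloch's hypothesis of Thm. (7.4) in the weakened
  form of Remark (7.5) ("there exist integers `a, b`, `a ≠ 0`, such that `a z₀ + b l₀^p` is the class of a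
  subscheme `Z₀ ⊂ X₀` which is semi-regular and a local complete intersection").
* `weilClassesOf A φ n d` (the Weil plane `⋀^{2n}_K H¹`, `K = ℚ(√-d) ↪ End⁰(A)` via `φ`, `φ ≫ φ = -d`),
  `Motives.IsHyperbolicWeilType` (the SPLIT component: `det H ≡ (-1)ⁿ mod Nm K^×`, van Geemen 5.2–5.4),
  `Motives.IsWeilSimilar` (same `K`-Hermitian similarity class = same deformation component, Deligne 1982,
  proof of Thm. 4.8), `WeilAnchorLocalClause n d P h w` (the LOCAL variational conclusion at the anchor:
  along every smooth projective family of `√-d`-Weil abelian `2n`-folds through `P`, `q·Hⁿ + W` is algebraic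
  on the fibres over an open neighbourhood of the anchor), `algebraicClasses X p`.

## The chain, one arrow per line (tree name · status)

(S)  seed: `HasBlochSeedAt n P h w` at ONE anchor `P` · OPEN — the cell's computation target (Bloch, Remark
     (7.5): "The problem of constructing semi-regular representatives for algebraic cycle classes of
     codimension `> 1` remains, however, wide open").
(B)  `BlochSemiregularSpread (2n) n` · NAMED FACT, REFEREED (Bloch 1972 Thm. (7.4)/(7.5) = Buchweitz–Flenner
     2003 Thm. 5.2 at `I = {n}` = Voisin, LNM 1594, L7 Thm. 2.4; class-level form on the tree's carriers;
     on-path: `HodgeConjecture → BlochSemiregularSpread n p`, `blochSemiregularSpread_of_hodgeConjecture`).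
(L)  (S) ∧ (B) ⟹ `WeilAnchorLocalClause n d P h w` · KERNEL THEOREM
     (`weilAnchorLocalClause_of_blochSpread_of_blochSeedAt`): the variational Hodge conjecture for `q·hⁿ + w`
     ALONG EVERY Weil family through the anchor, LOCALLY (an analytic-open neighbourhood of the anchor).
(G)  local ⟹ global on the component · KERNEL THEOREMS of the Hodge summit's Weil ladder: the algebraicity
     locus of a flat family of Hodge classes is a countable union of closed ALGEBRAIC subsets (Cattani–Deligne–
     Kaplan / Charles–Schnell Prop. 11.3.11, discharged in the tree) + Baire + Mumford's curve lemma
     (`mem_algebraicClasses_of_isOpen_subset_algebraicityLocus`), Lefschetz `(1,1)` to subtract `q·Hⁿ`, "one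
     non-zero algebraic Weil class suffices" (`K`-action), isogeny transfer.
(R)  reach: Deligne's polarized PEL family through the anchor reaches every member of the anchor's component ·
     NAMED FACTS, REFEREED: `weilFamilyReach_hyperbolic` (split component), `weilFamilyReach_similar` (the
     component of any anchor, indexed by Weil-similarity) — Deligne 1982 proof of Thm. 4.8, van Geemen 5.2–5.11,
     Landherr 1936, Mumford–Fogarty–Kirwan, Milne.
NOT NEEDED by this chain (answer to the coordinator's C1/C4): no density of CM points / André–Oort statement
and no finiteness of Mumford–Tate types — (G)+(R) replace "CM points are dense on the Hodge-locus component"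
by "the anchor's explicit Deligne family IS the component and algebraicity spreads from any one point of it";
finiteness per `g` matters only for aggregating components, which nothing here does.

## What ONE successful computation closes (theorems of this file, hypotheses by name)

* (L) is the tree theorem `weilAnchorLocalClause_of_blochSpread_of_blochSeedAt`: local VHC at the anchor, every `d`.
* `weilClasses_algebraic_of_similar_seed` — (S)(B)(R-similar)(G): the Weil plane of EVERY `√-d`-Weil `2n`-fold
  Weil-similar to the seeded anchor (= every member of the anchor's deformation component carrying a
  non-zero `(n,n)` Weil class) is algebraic. THE NAMED CASE of a seed at a NON-split CM sixfold (`n = 3`):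
  new in print (Markman 2025 covers the split sixfold component only; Schoen 1988/1998: `ℚ(√-3)`, `ℚ(√-1)`
  special cases).
* `weilClasses_algebraic_split_of_hyperbolic_seed` — (S at a split anchor)(B)(R-hyperbolic)(G): every split
  `√-d`-Weil `2n`-fold. At `n = 2` this is the cell's STEP-0 target (re-derive Markman's fourfold theorem on
  the split component from ONE semiregular lci surface on a split CM fourfold, e.g. `E⁴`); at `n = 3` it
  re-derives Markman 2025 Thm. 1.5.1 (split sixfolds) from ONE lci threefold, by REFEREED inputs only.
* the Hodge summit's ladder rungs from seeds are listed BY NAME at the end (tree theorems, not restated: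
  Markman's floor from sixfold seeds, ALL sixfolds from one eightfold seed per `d`, the CM door
  `HasCMBlochSeeds d` under the registered open stub `CMAnchoredWeilFamilyAllD`).
* `HasSemiregularWeilRepresentative n d` / `HasNonsplitSemiregularWeilRepresentative n d` — the cell's VERDICT
  SHAPES (existential: SOME anchor of the given kind carries a seed for SOME non-zero rational Weil class).

## What is deliberately NOT here

No scheme `E⁶` is constructed (the tree has no CM elliptic curve as a `Scheme` with computed Hodge
cohomology), so no INSTANCE of a seed is asserted; the cell's census result enters the ledger as evidence
(exact certificates), and `Certificate.lean` states precisely which matrix identity it must certify. No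
sheaf-theoretic seeds (Buchweitz–Flenner Thm. 5.1 / Perry / Markman's reflexive sheaves): the tree's
object-level door for those is `hasLocallyAlgebraicWeilAnchor_of_perryTwisted_kappaAnchorObject`
(UNREFEREED input `Perry2026_…`); this venture's transfer uses Bloch's lci theorem only.

## References (as printed; typed in the tree's Literature files cited above)

* [Bloch1972Semiregularity] S. Bloch, Semi-regularity and de Rham cohomology, Invent. Math. 17 (1972) 51–66:
  §1 (definition of `π` by duality), Thm. (7.1), (7.3), (7.4), Remark (7.5).
* [BuchweitzFlenner2003] R.-O. Buchweitz, H. Flenner, A semiregularity map for modules and applications to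
  deformations, Compositio Math. 137 (2003) 135–210: Def. 4.10, Thm. 5.1, Thm. 5.2, (8.1), Prop. 8.2.
* [Deligne1982HodgeCycles] P. Deligne, Hodge cycles on abelian varieties, LNM 900 (1982), proof of Thm. 4.8.
* [vanGeemen1994HodgeAV] B. van Geemen, An introduction to the Hodge conjecture for abelian varieties, LNM 1594
  (1994), 4.9, 5.2–5.11, 6.12.
* [Markman2025SecantWeil] E. Markman, arXiv:2502.03415, Thm. 1.5.1 (split sixfolds), Cor. 1.6.1 (fourfolds).
* [CharlesSchnell2014Notes] F. Charles, C. Schnell, Notes on absolute Hodge classes, Prop. 11.3.11.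
-/

noncomputable section

open CategoryTheory AlgebraicGeometry

namespace Summit.Ventures.HSemireg

open Literature.AlgebraicGeometry Literature.AlgebraicGeometry.Motives
open Literature.AlgebraicGeometry.HodgeTheory
open Literature.AlgebraicTopology.SingularHomology
open Summit.HodgeConjecture.HodgeConjecture.WeilTypeLadder

/-! ## The `K`-symmetrised hyperplane class of an anchor -/

/-- The **`K`-symmetrised hyperplane class** `h_K := d·ι^*a + ψ₀^*ι^*a ∈ H²(P(ℂ); ℂ)` of an abelian variety `P`
with `ψ₀ : P ⟶ P` (intended `ψ₀ ≫ ψ₀ = -d`, `K = ℚ(√-d)`), a projective embedding `ι : P ↪ ℙᴺ` and a class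
`a ∈ H²(ℙᴺ(ℂ); ℂ)` (intended rational and non-zero): the polarization class in which the tree's Weil-anchor
predicates (`HasHyperbolicBlochSeed`, `Motives.IsHyperbolicWeilType`, `Motives.IsWeilSimilar`,
`weilFamilyReach_hyperbolic/similar`) are uniformly phrased; `ψ₀^* h_K = d·h_K`. A reducible abbreviation of
that recurring sub-term (it unfolds by `rfl`), not a new notion. [cite: vanGeemen1994HodgeAV, Lemma 5.2]
[cite: Markman2025SecantWeil, §1.5] -/
abbrev symmetrisedClass (d : ℕ) (P : AbelianVariety ℂ) (ψ₀ : P ⟶ P) (ι : ProjectiveEmbedding P.X)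
    (a : complexBetti (projectiveSpace ι.n ℂ) 2) : complexBetti P.X 2 :=
  (d : ℂ) • complexBetti.map ι.ι 2 a + complexBetti.map ψ₀.hom.hom.hom 2 (complexBetti.map ι.ι 2 a)

/-! ## The cell's verdict shapes (existential seed predicates) -/

/-- **Verdict shape V1 — "Weil classes on `√-d`-Weil abelian `2n`-folds admit a semiregular algebraic
representative somewhere"**: there is an ANCHOR — a complex abelian `2n`-fold `P` with `ψ₀ ≫ ψ₀ = -(d • 𝟙 P)`,
a projective embedding `ι` and a non-zero rational `a ∈ H²(ℙᴺ(ℂ); ℂ)` — carrying a NON-ZERO RATIONAL class `w`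
of Hodge type `(n,n)` in its Weil plane `weilClassesOf P ψ₀ n d` and a Bloch seed for some `q·h_Kⁿ + w`
(`HasBlochSeedAt n P h_K w`: an integral Bloch-semiregular lci `Z ↪ P` of codimension `n` with `q·h_Kⁿ + w`
supported on `Z`). The component of the anchor (split or not) is NOT constrained; the intended anchors of
the cell are CM points (`P ~ Eⁿ ⊗ 𝒪_K`, i.e. `E^{2n}` with the signature-`(n,n)` action), where `w` is an
explicit polynomial in divisor classes and `π` is exactly computable. Distinguishes-from:
`HasHyperbolicBlochSeed n d` (tree) = this predicate PLUS hyperbolicity of `(P, ψ₀, h_K)` minus the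
`(n,n)`-clause; `HasSimilarBlochSeeds n d` (tree) asks a seed for EVERY target. PREDICATE, nothing
asserted; a design input in the sense of Bloch's Remark (7.5), not a case of the Hodge conjecture.
[cite: Bloch1972Semiregularity, Thm. (7.4) and Remark (7.5)] [cite: vanGeemen1994HodgeAV, 4.9 and Lemma 5.2] -/
def HasSemiregularWeilRepresentative (n d : ℕ) : Prop :=
  ∃ (P : AbelianVariety ℂ) (ψ₀ : P ⟶ P) (ι : ProjectiveEmbedding P.X)
    (a : complexBetti (projectiveSpace ι.n ℂ) 2) (w : complexBetti P.X (2 * n)),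
    P.dim = 2 * n ∧ ψ₀ ≫ ψ₀ = -(d • 𝟙 P) ∧ IsRationalClass a ∧ a ≠ 0 ∧
    w ∈ weilClassesOf P ψ₀ n d ∧ IsRationalClass w ∧ w ≠ 0 ∧ IsOfHodgeType (2 * n) P.X (2 * n) n n w ∧
    HasBlochSeedAt n P (symmetrisedClass d P ψ₀ ι a) w

/-- **Verdict shape V1′ — a semiregular representative on a NON-split anchor** (the cell's FIRST OPEN
TARGET at `n = 3`: sixfold components with `det H ≢ -1 mod Nm K^×`, e.g. `E⁶` with a weighted product
polarization whose weight product is not a norm): `HasSemiregularWeilRepresentative n d` with the anchor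
`(P, ψ₀, h_K)` NOT of hyperbolic Weil type (`¬ Motives.IsHyperbolicWeilType`). PREDICATE, nothing asserted.
[cite: Bloch1972Semiregularity, Remark (7.5)] [cite: vanGeemen1994HodgeAV, 5.2–5.4 (det H)] -/
def HasNonsplitSemiregularWeilRepresentative (n d : ℕ) : Prop :=
  ∃ (P : AbelianVariety ℂ) (ψ₀ : P ⟶ P) (ι : ProjectiveEmbedding P.X)
    (a : complexBetti (projectiveSpace ι.n ℂ) 2) (w : complexBetti P.X (2 * n)),
    P.dim = 2 * n ∧ ψ₀ ≫ ψ₀ = -(d • 𝟙 P) ∧ IsRationalClass a ∧ a ≠ 0 ∧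
    ¬ IsHyperbolicWeilType P ψ₀ n (symmetrisedClass d P ψ₀ ι a) ∧
    w ∈ weilClassesOf P ψ₀ n d ∧ IsRationalClass w ∧ w ≠ 0 ∧ IsOfHodgeType (2 * n) P.X (2 * n) n n w ∧
    HasBlochSeedAt n P (symmetrisedClass d P ψ₀ ι a) w

/-- V1′ is a special case of V1 (drop the non-hyperbolicity clause). [folklore] -/
theorem HasNonsplitSemiregularWeilRepresentative.hasSemiregularWeilRepresentative {n d : ℕ}
    (h : HasNonsplitSemiregularWeilRepresentative n d) : HasSemiregularWeilRepresentative n d := by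
  obtain ⟨P, ψ₀, ι, a, w, hP, hψ, ha, ha0, -, hwW, hwr, hw0, hwH, hseed⟩ := h
  exact ⟨P, ψ₀, ι, a, w, hP, hψ, ha, ha0, hwW, hwr, hw0, hwH, hseed⟩

/-- A hyperbolic Bloch seed (tree predicate `HasHyperbolicBlochSeed n d`) whose Weil class is of type `(n,n)`
is an instance of V1. (The `(n,n)` clause is automatic on an anchor of Weil type `(n,n)`, where the whole Weil
plane is of type `(n,n)`; it is kept explicit because the reach facts consume it.) [folklore] -/
theorem hasSemiregularWeilRepresentative_of_hyperbolicBlochSeed {n d : ℕ}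
    (h : ∃ (P : AbelianVariety ℂ) (ψ₀ : P ⟶ P) (ι : ProjectiveEmbedding P.X)
      (a : complexBetti (projectiveSpace ι.n ℂ) 2) (w : complexBetti P.X (2 * n)),
      P.dim = 2 * n ∧ ψ₀ ≫ ψ₀ = -(d • 𝟙 P) ∧ IsRationalClass a ∧ a ≠ 0 ∧
      IsHyperbolicWeilType P ψ₀ n (symmetrisedClass d P ψ₀ ι a) ∧
      w ∈ weilClassesOf P ψ₀ n d ∧ IsRationalClass w ∧ w ≠ 0 ∧ IsOfHodgeType (2 * n) P.X (2 * n) n n w ∧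
      HasBlochSeedAt n P (symmetrisedClass d P ψ₀ ι a) w) :
    HasSemiregularWeilRepresentative n d ∧ HasHyperbolicBlochSeed n d := by
  obtain ⟨P, ψ₀, ι, a, w, hP, hψ, ha, ha0, hhyp, hwW, hwr, hw0, hwH, hseed⟩ := h
  exact ⟨⟨P, ψ₀, ι, a, w, hP, hψ, ha, ha0, hwW, hwr, hw0, hwH, hseed⟩,
    ⟨P, ψ₀, ι, a, w, hP, hψ, ha, ha0, hhyp, hwW, hwr, hw0, hseed⟩⟩

/-! ## (L) The local transfer: a seed ⟹ the variational Hodge conjecture near the anchor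

This arrow is the tree theorem `weilAnchorLocalClause_of_blochSpread_of_blochSeedAt (d) (hB :
BlochSemiregularSpread (2 * n) n) (hS : HasBlochSeedAt n P h w) : WeilAnchorLocalClause n d P h w`
(`Literature/AlgebraicGeometry/HodgeTheory/WeilClassesBlochSeed.lean`), used below by name; it is not
restated here. -/

/-! ## (S)(B)(R)(G) The named cases one computed seed closes -/

/-- **The component of the seeded anchor (any component, split or not).** Granting Bloch's theorem
`BlochSemiregularSpread (2n) n` and Deligne's reach-by-similitude fact `weilFamilyReach_similar` (both
REFEREED named facts), ONE anchor `(P, ψ₀, ι, a)` of dimension `2n` (`n, d ≥ 1`) with a non-zero rational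
`(n,n)` Weil class `w` and a Bloch seed for `q·h_Kⁿ + w` makes the Weil plane of EVERY `√-d`-Weil abelian
`2n`-fold `(A, φ)` that carries a non-zero `(n,n)` Weil class and is Weil-similar to the anchor (for some
`K`-symmetrised hyperplane class of `A`) ALGEBRAIC: `weilClassesOf A φ n d ≤ algebraicClasses A.X n`.
Mechanism (all in the tree): (L) at the anchor; Deligne's family from `P` reaches `A` (reach fact); the
algebraicity locus is a countable union of closed algebraic sets, so an open piece is everything (Baire,
Charles–Schnell); subtract `q·Hⁿ` by Lefschetz `(1,1)`; one non-zero algebraic Weil class suffices; isogeny.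
At `n = 3` and a NON-split CM anchor this is a case of the Hodge conjecture not in print.
[cite: Bloch1972Semiregularity, Thm. (7.4) and Remark (7.5)] [cite: Deligne1982HodgeCycles, proof of Thm. 4.8]
[cite: CharlesSchnell2014Notes, Prop. 11.3.11] [cite: vanGeemen1994HodgeAV, proof of Thm. 6.12] -/
theorem weilClasses_algebraic_of_similar_seed {n d : ℕ} (hn : 1 ≤ n) (hd : 1 ≤ d)
    (hB : BlochSemiregularSpread (2 * n) n) (hF : weilFamilyReach_similar)
    (P : AbelianVariety ℂ) (ψ₀ : P ⟶ P) (ι : ProjectiveEmbedding P.X) (a : complexBetti (projectiveSpace ι.n ℂ) 2)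
    (w : complexBetti P.X (2 * n)) (hP : P.dim = 2 * n) (hψ : ψ₀ ≫ ψ₀ = -(d • 𝟙 P)) (ha : IsRationalClass a)
    (ha0 : a ≠ 0) (hwW : w ∈ weilClassesOf P ψ₀ n d) (hwr : IsRationalClass w) (hw0 : w ≠ 0)
    (hwH : IsOfHodgeType (2 * n) P.X (2 * n) n n w) (hS : HasBlochSeedAt n P (symmetrisedClass d P ψ₀ ι a) w)
    (A : AbelianVariety ℂ) (φ : A ⟶ A) (hA : A.dim = 2 * n) (hφ : φ ≫ φ = -(d • 𝟙 A))
    (hWA : ∃ wA : complexBetti A.X (2 * n),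
      wA ∈ weilClassesOf A φ n d ∧ wA ≠ 0 ∧ IsOfHodgeType (2 * n) A.X (2 * n) n n wA)
    (eA : ProjectiveEmbedding A.X) (aA : complexBetti (projectiveSpace eA.n ℂ) 2) (haA : IsRationalClass aA)
    (haA0 : aA ≠ 0)
    (hsim : IsWeilSimilar n P ψ₀ (symmetrisedClass d P ψ₀ ι a) A φ (symmetrisedClass d A φ eA aA)) :
    weilClassesOf A φ n d ≤ algebraicClasses A.X n :=
  weilClassesOf_le_algebraicClasses_of_reachSimilar_of_similarAnchor hF hn hd A φ hA hφ hWA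
    ⟨eA, aA, P, ψ₀, ι, a, w, haA, haA0, hP, hψ, ha, ha0, hwW, hwr, hw0, hwH,
      weilAnchorLocalClause_of_blochSpread_of_blochSeedAt d hB hS, hsim⟩

/-- **Verdict V1 read through the chain**: granting Bloch's theorem and reach-by-similitude, a semiregular
Weil representative somewhere (`HasSemiregularWeilRepresentative n d`) yields an ANCHOR `(P, ψ₀, h_K)` whose whole
deformation component is settled — every `√-d`-Weil `2n`-fold with a non-zero `(n,n)` Weil class that is
Weil-similar to the anchor has algebraic Weil plane. (Existential repackaging of
`weilClasses_algebraic_of_similar_seed`.) [cite: Bloch1972Semiregularity, Thm. (7.4) and Remark (7.5)]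
[cite: Deligne1982HodgeCycles, proof of Thm. 4.8] -/
theorem exists_settled_component_of_hasSemiregularWeilRepresentative {n d : ℕ} (hn : 1 ≤ n) (hd : 1 ≤ d)
    (hB : BlochSemiregularSpread (2 * n) n) (hF : weilFamilyReach_similar)
    (h : HasSemiregularWeilRepresentative n d) :
    ∃ (P : AbelianVariety ℂ) (ψ₀ : P ⟶ P) (ι : ProjectiveEmbedding P.X) (a : complexBetti (projectiveSpace ι.n ℂ) 2),
      P.dim = 2 * n ∧ ψ₀ ≫ ψ₀ = -(d • 𝟙 P) ∧ IsRationalClass a ∧ a ≠ 0 ∧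
      ∀ (A : AbelianVariety ℂ) (φ : A ⟶ A), A.dim = 2 * n → φ ≫ φ = -(d • 𝟙 A) →
        (∃ wA : complexBetti A.X (2 * n),
          wA ∈ weilClassesOf A φ n d ∧ wA ≠ 0 ∧ IsOfHodgeType (2 * n) A.X (2 * n) n n wA) →
        ∀ (eA : ProjectiveEmbedding A.X) (aA : complexBetti (projectiveSpace eA.n ℂ) 2),
          IsRationalClass aA → aA ≠ 0 →
          IsWeilSimilar n P ψ₀ (symmetrisedClass d P ψ₀ ι a) A φ (symmetrisedClass d A φ eA aA) →
          weilClassesOf A φ n d ≤ algebraicClasses A.X n := by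
  obtain ⟨P, ψ₀, ι, a, w, hP, hψ, ha, ha0, hwW, hwr, hw0, hwH, hseed⟩ := h
  exact ⟨P, ψ₀, ι, a, hP, hψ, ha, ha0, fun A φ hA hφ hWA eA aA haA haA0 hsim =>
    weilClasses_algebraic_of_similar_seed hn hd hB hF P ψ₀ ι a w hP hψ ha ha0 hwW hwr hw0 hwH hseed A φ hA hφ
      hWA eA aA haA haA0 hsim⟩

/-- **The split component (every split `√-d`-Weil `2n`-fold) from ONE hyperbolic seed.** Granting Bloch's
theorem `BlochSemiregularSpread (2n) n` and Deligne's hyperbolic reach fact `weilFamilyReach_hyperbolic` (both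
REFEREED), one seed on one SPLIT anchor (`HasHyperbolicBlochSeed n d`, e.g. the CM point `E^{2n}` with the
product polarization) makes the Weil plane of EVERY `√-d`-Weil abelian `2n`-fold of hyperbolic (split) type
algebraic (`n, d ≥ 1`). `n = 2`: the cell's STEP-0 (Markman's fourfold theorem on the split component, by
Bloch's route); `n = 3`: Markman 2025 Thm. 1.5.1 (split sixfolds) re-derived from refereed inputs plus one
lci threefold. (Composition of `hasLocallyAlgebraicWeilAnchor_of_blochSpread_of_hyperbolicBlochSeed` and
`weilClasses_algebraic_hyperbolic_of_localAnchor`.) [cite: Bloch1972Semiregularity, Thm. (7.4) and Remark (7.5)]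
[cite: Deligne1982HodgeCycles, proof of Thm. 4.8] [cite: Markman2025SecantWeil, Thm. 1.5.1 and Cor. 1.6.1] -/
theorem weilClasses_algebraic_split_of_hyperbolic_seed (n d : ℕ) (hn : 1 ≤ n) (hd : 1 ≤ d)
    (hB : BlochSemiregularSpread (2 * n) n) (hF : weilFamilyReach_hyperbolic) (hS : HasHyperbolicBlochSeed n d)
    (A : AbelianVariety ℂ) (φ : A ⟶ A) (hA : A.dim = 2 * n) (hφ : φ ≫ φ = -(d • 𝟙 A))
    (eA : ProjectiveEmbedding A.X) (aA : complexBetti (projectiveSpace eA.n ℂ) 2) (haA : IsRationalClass aA)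
    (haA0 : aA ≠ 0) (hhypA : IsHyperbolicWeilType A φ n (symmetrisedClass d A φ eA aA)) :
    weilClassesOf A φ n d ≤ algebraicClasses A.X n :=
  weilClasses_algebraic_hyperbolic_of_localAnchor n d hn hd
    (hasLocallyAlgebraicWeilAnchor_of_blochSpread_of_hyperbolicBlochSeed hB hS) hF A φ hA hφ eA aA haA haA0 hhypA

/-- **STEP-0 shape (`n = 2`): split Weil fourfolds from one semiregular lci SURFACE on a split CM fourfold.**
[cite: Bloch1972Semiregularity, Thm. (7.4)] [cite: Markman2025SecantWeil, Cor. 1.6.1] -/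
theorem weilFourfolds_split_of_hyperbolic_seed (d : ℕ) (hd : 1 ≤ d) (hB : BlochSemiregularSpread 4 2)
    (hF : weilFamilyReach_hyperbolic) (hS : HasHyperbolicBlochSeed 2 d)
    (A : AbelianVariety ℂ) (φ : A ⟶ A) (hA : A.dim = 4) (hφ : φ ≫ φ = -(d • 𝟙 A))
    (eA : ProjectiveEmbedding A.X) (aA : complexBetti (projectiveSpace eA.n ℂ) 2) (haA : IsRationalClass aA)
    (haA0 : aA ≠ 0) (hhypA : IsHyperbolicWeilType A φ 2 (symmetrisedClass d A φ eA aA)) :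
    weilClassesOf A φ 2 d ≤ algebraicClasses A.X 2 :=
  weilClasses_algebraic_split_of_hyperbolic_seed 2 d (by norm_num) hd hB hF hS A φ hA hφ eA aA haA haA0 hhypA

/-- **First target shape (`n = 3`): split Weil sixfolds from one semiregular lci THREEFOLD on a split CM
sixfold** (Markman 2025 Thm. 1.5.1 by Bloch's route). [cite: Bloch1972Semiregularity, Thm. (7.4)]
[cite: Markman2025SecantWeil, Thm. 1.5.1] -/
theorem weilSixfolds_split_of_hyperbolic_seed (d : ℕ) (hd : 1 ≤ d) (hB : BlochSemiregularSpread 6 3)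
    (hF : weilFamilyReach_hyperbolic) (hS : HasHyperbolicBlochSeed 3 d)
    (A : AbelianVariety ℂ) (φ : A ⟶ A) (hA : A.dim = 6) (hφ : φ ≫ φ = -(d • 𝟙 A))
    (eA : ProjectiveEmbedding A.X) (aA : complexBetti (projectiveSpace eA.n ℂ) 2) (haA : IsRationalClass aA)
    (haA0 : aA ≠ 0) (hhypA : IsHyperbolicWeilType A φ 3 (symmetrisedClass d A φ eA aA)) :
    weilClassesOf A φ 3 d ≤ algebraicClasses A.X 3 :=
  weilClasses_algebraic_split_of_hyperbolic_seed 3 d (by norm_num) hd hB hF hS A φ hA hφ eA aA haA haA0 hhypA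

/-! ## The Hodge summit's ladder rungs from seeds (tree theorems, by name — not restated)

* Markman's 2025 floor (split sixfolds ∧ all fourfolds, as the tree's named facts
  `Markman2025_weilClasses_algebraic_hyperbolicSixfold ∧ Markman2025_weilClasses_algebraic_abelianFourfold`) ⟸
  `weilFamilyReach_hyperbolic ∧ BlochSemiregularSpread (2*3) 3 ∧ ∀ d ≥ 1, HasHyperbolicBlochSeed 3 d`:
  `Summit.HodgeConjecture.HodgeConjecture.WeilTypeLadder.floor_of_reach_of_blochSpread_of_seeds`.
* ALL `√-d`-Weil sixfolds, every `d`, every component (the summit item `Theses.SevenfoldWeilCensus.WeilSixfolds`)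
  ⟸ reach ∧ `BlochSemiregularSpread (2*4) 4` ∧ ONE hyperbolic seed in dimension EIGHT per `d`
  (`…WeilTypeLadder.weilSixfolds_of_reach_of_blochSpread_of_seeds_four`; the degeneration R2₈ ⟹ R1 is
  unconditional in the tree) — so the CM eightfold `E⁸` is the cell's highest-leverage single anchor;
  ⟸ the CM door `CMAnchoredWeilFamilyAllD ∧ BlochSemiregularSpread 6 3 ∧ ∀ d ≥ 1, HasCMBlochSeeds d`
  (`…WeilTypeLadder.weilSixfolds_of_cmAnchoredFamily_of_blochSpread_of_cmBlochSeeds`: seeds at the CM sixfolds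
  `Y ~ E⁶` for every `K`-symmetrised `θ` and every non-zero rational Weil class).
* On-path bookkeeping of the transport input: `HodgeConjecture → BlochSemiregularSpread n p`
  (`…WeilTypeLadder.blochSemiregularSpread_of_hodgeConjecture`); the seed predicates carry no such lemma
  (design inputs), the reach facts are moduli statements independent of HC. -/

end Summit.Ventures.HSemireg

end
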